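import Summits.QuantumFields.BalabanUV.Beta.GAN24.InsertionChainLawKing
import Summits.QuantumFields.BalabanUV.T4Continuum.Support.CTKingTowerWeights
import Summits.QuantumFields.BalabanUV.T4Continuum.Support.CTConjugatedHbd
import Summits.QuantumFields.BalabanUV.T4Continuum.Support.CTConjDefectDischarge
import Summits.QuantumFields.BalabanUV.T4Continuum.Support.CTAdmissibleRate

/-!
# `BalabanUV.Beta.GAN24.InsertionChainDecay` — binder row G-an2-4 ∕ (CONV-C), route R7 «TWO CURRENCIES», PART 124: THE DECAY HALF OF THE
# u-DERIVATIVE INSERTION CHAINS IN THE COMBES–THOMAS CURRENCY, AND THE JOIN.  The conjugation `X ↦ e^{κρ}Xe^{−κρ}` is multiplicative, so the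
# `n`-th insertion chain `T_n = (GP)^nG` has `‖e^{κρ}T_ne^{−κρ}‖ ≤ g·κ′^n` from the two weighted letters `‖e^{κρ}Ge^{−κρ}‖ ≤ g` (weighted
# coercivity of the free operator) and `‖e^{κρ}Pe^{−κρ}·e^{κρ}Ge^{−κρ}‖ ≤ κ′` (the conjugated (H-bd)); on King's tower of Bałaban's `Δ_a^{(k)}` at
# the canonical block weights this IS the level-uniform entry decay `hdec` of the unit-lattice images of `T_n` (the NE2 swarm's dictionary
# `CTAveragedTowerDecay.entryDecay_avgTow_of_conjInv`), and PART 116's operator-norm rate `L^{−k}` JOINS it (`DecayRateInterpolation`) into King's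
# (4.38) ∕ (CONV-C) shape `‖(c_{k+1} − c_k)(x,y)‖ ≤ B·(√(L⁻¹))^k·e^{−(κ∕2)·dist(x,y)}`, constants free of the level AND of the volume.  For the
# FIRST-ORDER MODEL (a Lipschitz connection `𝒜·∇` inserted `n` times into Bałaban's vector propagator) every letter is a tree theorem: the shape
# holds UNCONDITIONALLY, for every order `n`, at every rate `κ` below three closed-form thresholds in `(d, a, a′)`, and SOME `κ > 0` chosen before
# the torus, the background and the order (unit b2b-balaban-gan24-p3, gen 52; v1)

NOT IN PRINT; OUR PROOF ([folklore] finite-dimensional linear algebra BY NAME over: PART 115 ∕ 116 `GAN24/InsertionChainLaw(King)` (gen 51: the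
operator-norm rate of every insertion order on King's tower; `pow_mul_shift`, `opNorm_pow_le`); the NE2 formalisation swarm's «Δ3-CT» chain
`Support/CTAveragedTowerDecay` (`entryDecay_avgTow_of_conjInv`, `opNorm_conjMat_inv_le_of_wCoercive`, `conjMat_mul_same`), `Support/CTKingTowerWeights`
(the canonical site weights `rho k y`, the unit-lattice distance `distK`, (G1)∕(G2)), `Support/CTConjugatedHbd` (`opNorm_conjMat_firstOrder_le`,
`wCoercive_calDa_of_conjDefect`), `Support/CTConjDefectDischarge.conjDefect_calDalev_rho` (the `U = 1` conjugation defect of `Δ_a^{(k)}`, level-uniform —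
the substrate programme VEC's `CTVectorPropagator.conjDefect_DeltaA`), `Support/CTAdmissibleRate` (the `κ`-windows at `𝓝 0`); the substrate's
`CTWeightedCoercivity` (`conjMat`, `WCoercive`) and the row owner's `Support/DecayRateInterpolation.decayRate_of_towerLimitRate` (the join).
[King1986] Lemma 4.5 (4.38) p. 674 is the printed SHAPE of the conclusion (scalar `U(1)` Higgs), method reference only; nothing printed is a hypothesis).
HONEST FRAMING (cell contract, verbatim): «discharging `BetaPertH` makes Bałaban's UV stability UNCONDITIONAL — a real constructive-QFT result; it is NOT the
continuum limit and NOT the Clay problem.»  HONEST DEPENDENCY (verbatim): «continuum YM on T⁴ ⇐ BetaPertH ∧ nine spine estimates (0/9 proved); BetaPertH ⇐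
(D1) ∧ (D4) ∧ CAP+tail; G-an2-4 gates asym, D1 and NE2/3/4.»

WHY THIS FILE.  (CONV-C) asks, for each constituent kernel, BOTH a geometric rate in the level AND an exponential decay in the unit-lattice distance, with
constants depending on `(d, L, N)` only (ROUTES-GAN24 §0 (0.1)).  Route R7 («TWO CURRENCIES») prescribes: prove the RATE half in operator norm (no decay) and
the DECAY half level-uniformly (no rate), then join them by interpolation (`min ≤ geometric mean`: the tree's `GAN24/CombesThomas.decayCauchy_of_uniformDecays_supRate`
∕ `Support/DecayRateInterpolation`).  Gen 51 delivered the rate half for the u-DERIVATIVE sector — every insertion chain `T_n = (𝒢P)^n𝒢` — on King's tower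
(PART 116, `towerLimitRate_insertion_king`; for the first-order model UNCONDITIONALLY, `towerLimitRate_firstOrderInsertion`) and recorded as NEXT MATHEMATICS
«the decay half in a joinable currency — the engine is currency-agnostic: conjugate by a weight».  THIS FILE does exactly that.  The conjugation by the
Combes–Thomas weight is an algebra homomorphism (`conjMat_mul`), so the conjugated chain is the chain of the conjugated factors and its operator norm is
bounded by the product of the two weighted letters — NO rate is needed in the weighted norm (§1).  The NE2 swarm's dictionary turns a centre-uniform
conjugated bound at the canonical block weights into the entry decay of the King-averaged unit-lattice image (§2), the row owner's interpolation joins it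
with PART 116 (§3), and for the first-order model both weighted letters are tree theorems (`conjDefect_calDalev_rho` + `opNorm_conjMat_firstOrder_le`), so
the (CONV-C) SHAPE — rate `√(L⁻¹)` AND decay `κ∕2`, level- and volume-free constants — holds for every background-derivative insertion order with NO
displayed binder (§4–§5).  This closes, AT MODEL LEVEL and in R7's two currencies, both halves of (CONV-C) for the u-derivative insertion class that PARTs
115–116 opened; it is the first kernel theorem of the tree giving a BACKGROUND-DERIVATIVE constituent the literal rate-with-decay shape.

WHAT THIS FILE PROVES (0 sorry, 0 `def`, nothing cited; `conjMat κ ρ σ X (e,e′) = e^{κ(ρ_e − σ_{e′})}X(e,e′)`; `L ≥ 1` a block side, `M : Fin d → ℕ` the unit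
periods, `a > 0`; `Δ_a^{(k)} = calDalev k`, `Q_L = Qlev`, `J_k = JpcT`, `ρ_{k,y} = CTKingTowerWeights.rho k y`, `dist = distK` the unit-torus sup-distance):
* §1 (ANY finite index type, ANY weights) `conjMat_pow`, **`conjMat_insertion`** (`c((GP)^nG) = c(G)·(c(P)c(G))^n`), **`opNorm_conjMat_insertion_le`**
  (`‖c(G)‖ ≤ g`, `‖c(P)c(G)‖ ≤ κ′` ⟹ `‖c((GP)^nG)‖ ≤ g·κ′^n`), **`opNorm_conjMat_insertion_le_of_wCoercive`** (`G = D⁻¹`, `WCoercive D κ ρ γw` ⟹ `≤ γw⁻¹κ′^n`).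
* §2 (King's tower, ANY level operators `X_k`) **`hdec_of_conjBound`**: `∀ k y, ‖conjMat κ ρ_{k,y} ρ_{k,y} (X k)‖ ≤ K` (`κ ≥ 0`) ⟹
  `∀ k, EntryDecay distK ((L^d)^k·Q^{(k)}X_kQ^{(k)ᴴ}) (K·e^{2κ}) κ` — the plain-tower twin of `CTKingTowerWeights.hdec_pertCovC_of_conjInv`.
* §3 (King's tower, ANY perturbation family) **`hdec_insertion_of_wCoercive`** (`hW : ∀ k y, WCoercive (Δ_a^{(k)}) κ ρ_{k,y} γw`,
  `hPc : ∀ k y, ‖c(P_k)·c((Δ_a^{(k)})⁻¹)‖ ≤ κ′` ⟹ `hdec` for the `n`-th insertion tower with `(γw⁻¹κ′^n·e^{2κ}, κ)`); **`decayStations_insertion_king`** (`L ≥ 2`;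
  `PerturbationLaws (Δ_a^{(·)}) P J κ₀ (C₂L^{−k})` + `hW` + `hPc` ⟹ the limit of the unit-lattice images of `(𝒢^{(k)}P_k)^n𝒢^{(k)}` exists, has entry decay
  `(γw⁻¹κ′^n e^{2κ}, κ)`, and King's shapes hold: `DecayRate … (√(2B·C_n∕(1−L⁻¹))) (κ∕2) (√(L⁻¹))`, `TwoLevelDecayRate … (√(2B·2C_n∕(1−L⁻¹))) (κ∕2) (√(L⁻¹))`,
  `B = γw⁻¹κ′^n e^{2κ}`, `C_n = (n+1)κ₀^nCJ + nκ₀^{n−1}C₂ + κ₀^n·2dCst` — PART 116's constant); the NON-VACUITY face **`entryBound_insertion_of_perturbationLaws`**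
  (`κ = 0`: the two weighted letters ARE `DirichletRegionTower.coercive_calDalev` and (H-bd), so EVERY `PerturbationLaws` family has the unit-lattice entries of
  every insertion image bounded by `(d+1)Cst·κ₀^n`, uniformly in the level and the volume).
* §4 (the FIRST-ORDER MODEL `P_k = Σ_μ diag(V^{(k)}_μ)∇^{(k)}_μ`, `LipschitzBackground V α β`) **`hPc_firstOrder`** (the conjugated (H-bd) at the canonical weights from
  a conjugation-defect bound `J` of `Δ_a^{(k)}`: `≤ d·α·G2 d a J (γ_D − J) κ`), **`decayStations_firstOrderInsertion`** (`L ≥ 2`, `d ≥ 1`, `a′ > 0`, `κ ≥ 0` with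
  `Jfree d a′ κ 1 < γ′`, `deltaK d a′ κ 1 < σ₀²`, `JA d a a′ κ 1 < γ_D`): for EVERY order `n` the King-averaged unit-lattice images `c^{(n)}_k` of `(𝒢^{(k)}P_k)^n𝒢^{(k)}`
  converge to a limit with entry decay at rate `κ` and obey `‖(c^{(n)}_{k+1} − c^{(n)}_k)(x,y)‖ ≤ B_n·(√(L⁻¹))^k·e^{−(κ∕2)·distK(x,y)}` and the limit form — NO displayed
  binder, constants closed-form in `(d, L, a, a′, α, β, κ, n)`, free of `k` and of `M`.
* §5 **`exists_rate_firstOrderInsertion`**: `∃ κ ∈ (0, 1]` depending on `(d, a)` only (auxiliary mass `a′ = 1`) such that FOR ALL tori `M`, ALL Lipschitz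
  backgrounds and ALL orders `n` the two-level shape of §4 holds at decay rate `κ∕2` — the quantifier order of (CONV-C) («`∃θ, C₄, δ₄ (d, L, N)`»).
WHAT IT DOES NOT DO: Bałaban's Table-T vertices ∕ his covariant `Q_k(U)` (R7 S1; NE2's Bałaban-shaped perturbation is conditional on NE3's binder — §3 applies to
it BY NAME once its conjugated (H-bd) is fed, cf. `CTBalabanPertHbd`); mixed chains `GP₁GP₂G` (PART 119; the same two lines of algebra — left to a follower);
the effective form `Σ_k` (PART 118; needs the unit-lattice conjugation defect of `c_k` — follower); infinite volume (the torus is fixed, the constants are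
volume-free); an explicit number for `κ`.  SUPPLIER work (junction R7 × NE2's Δ3-CT chain); no consumer of record; NEVER «G-an2-4 closed»; NOT (CONV-C) (a
MODEL constituent class, King's averaging, first-order coupling), NOT D1, NOT `BetaPertH`, NOT continuum, NOT Clay.  Records: `HOME/b2b-balaban-gan24-p3/gen52/README.md`.
-/

noncomputable section

open scoped BigOperators ComplexConjugate Matrix Matrix.Norms.L2Operator
open Filter Topology

namespace Summit.QuantumFields.BalabanUV.Beta.GAN24.InsertionChainDecay

open Literature.MathematicalPhysics.QuantumFieldTheory.Balaban1983to89.B5Prop11Plancherel (Cst Cst_nonneg)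
open Literature.MathematicalPhysics.QuantumFieldTheory.Balaban1983to89.B5G183RateUnitTower (lev)
open Summit.QuantumFields.BalabanUV.T4Continuum
open Summit.QuantumFields.BalabanUV.T4Continuum.CoerciveInverseTower (Coercive)
open Summit.QuantumFields.BalabanUV.T4Continuum.CovariantAveragingTower (avgTow TowerLimitRate)
open Summit.QuantumFields.BalabanUV.T4Continuum.BalabanAveragedTowerUnit (idx Qlev calGlev one_le_lev' opNorm_Qlev_sq_le)
open Summit.QuantumFields.BalabanUV.T4Continuum.BackgroundResolventTower (PerturbationLaws)
open Summit.QuantumFields.BalabanUV.T4Continuum.KingPairingPlantedLaw (JpcT calDalev calDalev_inv CJ CJ_nonneg)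
open Summit.QuantumFields.BalabanUV.T4Continuum.FirstOrderBackgroundModel (LipschitzBackground Pmodel C2model perturbationLaws_firstOrder)
open Summit.QuantumFields.BalabanUV.T4Continuum.CTWeightedCoercivity (conjMat conjMat_one conjMat_zero WCoercive)
open Summit.QuantumFields.BalabanUV.T4Continuum.CTAveragedTowerDecay (conjMat_mul_same opNorm_conjMat_inv_le_of_wCoercive entryDecay_avgTow_of_conjInv
  wCoercive_zero_of_coercive)
open Summit.QuantumFields.BalabanUV.T4Continuum.CTKingTowerWeights (rho distK rho_nonpos_of_prtk distK_sub_two_le_rho abs_rho_fineStep_le)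
open Summit.QuantumFields.BalabanUV.T4Continuum.CTConjugatedHbd (G2 G2_nonneg wCoercive_calDa_of_conjDefect opNorm_conjMat_firstOrder_le)
open Summit.QuantumFields.BalabanUV.T4Continuum.CTConjDefectDischarge (conjDefect_calDalev_rho max_JA_lt_gamD)
open Summit.QuantumFields.BalabanUV.T4Continuum.CTAdmissibleRate (eventually_Jfree_lt eventually_deltaK_lt eventually_JA_lt exists_pos_le_one_of_eventually)
open Summit.QuantumFields.BalabanUV.T4Continuum.DirichletRegionTower (gamD gamD_pos coercive_calDalev)
open Summit.QuantumFields.BalabanUV.T4Continuum.ScalarAveragedPropagator (gammaPs)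
open Summit.QuantumFields.BalabanUV.T4Continuum.ScalarAveragedCompression (sigma0)
open Summit.QuantumFields.BalabanUV.T4Continuum.CTScalarGreen (Jfree)
open Summit.QuantumFields.BalabanUV.T4Continuum.CTGaugeTerm (deltaK)
open Summit.QuantumFields.BalabanUV.T4Continuum.CTVectorPropagator (JA)
open Summit.QuantumFields.BalabanUV.T4Continuum.BlockSumDecay (prtQ Qlev_indicator)
open Summit.QuantumFields.BalabanUV.T4Continuum.DecayRateInterpolation (EntryDecay DecayRate TwoLevelDecayRate decayRate_of_towerLimitRate)
open Summit.QuantumFields.BalabanUV.Beta.GAN24.InsertionChainLaw (pow_mul_shift opNorm_pow_le)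
open Summit.QuantumFields.BalabanUV.Beta.GAN24.InsertionChainLawKing (towerLimitRate_insertion_king)

/-! ## §1 The conjugation is multiplicative: the conjugated insertion chain and its bound from the two weighted letters -/

section Conj

variable {ι : Type*} [Fintype ι] [DecidableEq ι]

/-- powers commute with the conjugation: `c(X^n) = c(X)^n`. [folklore] -/
theorem conjMat_pow (κ : ℝ) (ρ : ι → ℝ) (X : Matrix ι ι ℂ) (n : ℕ) : conjMat κ ρ ρ (X ^ n) = (conjMat κ ρ ρ X) ^ n := by
  induction n with
  | zero => rw [pow_zero, pow_zero, conjMat_one]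
  | succ n ih => rw [pow_succ, pow_succ, conjMat_mul_same, ih]

/-- **the conjugated insertion chain**: `c((GP)^nG) = c(G)·(c(P)·c(G))^n` (shift `(GP)^nG = G(PG)^n`, then multiplicativity). [our proof] -/
theorem conjMat_insertion (κ : ℝ) (ρ : ι → ℝ) (G P : Matrix ι ι ℂ) (n : ℕ) :
    conjMat κ ρ ρ ((G * P) ^ n * G) = conjMat κ ρ ρ G * (conjMat κ ρ ρ P * conjMat κ ρ ρ G) ^ n := by
  rw [pow_mul_shift, conjMat_mul_same, conjMat_pow, conjMat_mul_same]

/-- **`opNorm_conjMat_insertion_le` — THE DECAY LETTER OF THE `n`-TH INSERTION CHAIN FROM THE TWO WEIGHTED LETTERS** [our proof]: `‖c(G)‖ ≤ g` (weighted bound of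
the free propagator) and `‖c(P)·c(G)‖ ≤ κ′` (the conjugated (H-bd)) ⟹ `‖c((GP)^nG)‖ ≤ g·κ′^n`.  No rate, no smallness: the chain is polynomial in `P`. -/
theorem opNorm_conjMat_insertion_le {G P : Matrix ι ι ℂ} {κ : ℝ} {ρ : ι → ℝ} {g κ' : ℝ} (hG : ‖conjMat κ ρ ρ G‖ ≤ g)
    (hP : ‖conjMat κ ρ ρ P * conjMat κ ρ ρ G‖ ≤ κ') (n : ℕ) : ‖conjMat κ ρ ρ ((G * P) ^ n * G)‖ ≤ g * κ' ^ n := by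
  rw [conjMat_insertion]
  have hg : 0 ≤ g := (norm_nonneg _).trans hG
  exact (Matrix.l2_opNorm_mul _ _).trans (mul_le_mul hG (opNorm_pow_le hP n) (norm_nonneg _) hg)

/-- **the same with `G = D⁻¹` under weighted coercivity**: `WCoercive D κ ρ γw`, `γw > 0`, `‖c(P)·c(D⁻¹)‖ ≤ κ′` ⟹ `‖c((D⁻¹P)^nD⁻¹)‖ ≤ γw⁻¹·κ′^n`
(`‖c(D⁻¹)‖ ≤ γw⁻¹` is the Δ3-CT chain's `opNorm_conjMat_inv_le_of_wCoercive`). [our proof] -/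
theorem opNorm_conjMat_insertion_le_of_wCoercive {D P : Matrix ι ι ℂ} {κ : ℝ} {ρ : ι → ℝ} {γw κ' : ℝ} (hW : WCoercive D κ ρ γw)
    (hγ : 0 < γw) (hP : ‖conjMat κ ρ ρ P * conjMat κ ρ ρ D⁻¹‖ ≤ κ') (n : ℕ) :
    ‖conjMat κ ρ ρ ((D⁻¹ * P) ^ n * D⁻¹)‖ ≤ γw⁻¹ * κ' ^ n :=
  opNorm_conjMat_insertion_le (opNorm_conjMat_inv_le_of_wCoercive hW hγ) hP n

end Conj

/-! ## §2 King's tower: a centre-uniform conjugated bound on the level operators IS the entry decay of their unit-lattice images -/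

section Tower

variable {d : ℕ} (L : ℕ) [NeZero L] (M : Fin d → ℕ) [hM : ∀ μ, NeZero (M μ)]

/-- **`hdec_of_conjBound` — THE COMBES–THOMAS DICTIONARY ON KING's (PLAIN) TOWER** [our proof]: for ANY level operators `X_k` on
`idx L M k = Tor (fine L^k M) × Fin d`, a centre-uniform bound `‖conjMat κ ρ_{k,y} ρ_{k,y} (X k)‖ ≤ K` at the canonical site weights (`κ ≥ 0`) gives
`EntryDecay distK ((L^d)^k·Q^{(k)}X_kQ^{(k)ᴴ}) (K·e^{2κ}) κ` at EVERY level — `CTAveragedTowerDecay.entryDecay_avgTow_of_conjInv` with King's indicator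
structure (`BlockSumDecay.Qlev_indicator`) and the weight geometry (G2a)∕(G2b) of `CTKingTowerWeights` (the plain-tower twin of its `hdec_pertCovC_of_conjInv`). -/
theorem hdec_of_conjBound {X : (k : ℕ) → Matrix (idx L M k) (idx L M k) ℂ} {κ K : ℝ} (hκ : 0 ≤ κ)
    (hK : ∀ (k : ℕ) (y : idx L M 0), ‖conjMat κ (rho L M k y) (rho L M k y) (X k)‖ ≤ K) (k : ℕ) :
    EntryDecay (distK L M) (avgTow (Qlev L M) ((L : ℝ) ^ d) X k) (K * Real.exp (κ * 2)) κ := by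
  have hLd : (0 : ℝ) < (L : ℝ) ^ d := pow_pos (by exact_mod_cast Nat.pos_of_ne_zero (NeZero.ne L)) d
  exact entryDecay_avgTow_of_conjInv (X := X) (k := k) (dist := distK L M) (c := 2) (Qlev_indicator L M) hLd (opNorm_Qlev_sq_le L M) hκ
    (fun y => rho L M k y) (hK k) (fun y u hu => rho_nonpos_of_prtk L M k y u hu) (fun x y u hu => distK_sub_two_le_rho L M k x y u hu)

variable (a : ℝ) (ha : 0 < a)

/-! ## §3 King's tower of Bałaban's `Δ_a^{(k)}`: `hdec` for every insertion order from the two weighted letters, and the JOIN with PART 116 -/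

/-- **`hdec_insertion_of_wCoercive` — THE DECAY HALF FOR EVERY INSERTION ORDER** [our proof]: the `U = 1` weighted coercivity
`hW : ∀ k y, WCoercive (Δ_a^{(k)}) κ ρ_{k,y} γw` and the conjugated (H-bd) `hPc : ∀ k y, ‖c(P_k)·c((Δ_a^{(k)})⁻¹)‖ ≤ κ′` (both at the canonical weights) give,
for every order `n` and every level `k`, `EntryDecay distK ((L^d)^k·Q^{(k)}(𝒢^{(k)}P_k)^n𝒢^{(k)}Q^{(k)ᴴ}) (γw⁻¹κ′^n·e^{2κ}) κ` — level- and volume-free. -/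
theorem hdec_insertion_of_wCoercive {P : (k : ℕ) → Matrix (idx L M k) (idx L M k) ℂ} {κ γw κ' : ℝ} (hκ : 0 ≤ κ) (hγ : 0 < γw)
    (hW : ∀ (k : ℕ) (y : idx L M 0), WCoercive (calDalev L M a ha k) κ (rho L M k y) γw)
    (hPc : ∀ (k : ℕ) (y : idx L M 0),
      ‖conjMat κ (rho L M k y) (rho L M k y) (P k) * conjMat κ (rho L M k y) (rho L M k y) (calDalev L M a ha k)⁻¹‖ ≤ κ')
    (n k : ℕ) :
    EntryDecay (distK L M)
      (avgTow (Qlev L M) ((L : ℝ) ^ d) (fun k => ((calDalev L M a ha k)⁻¹ * P k) ^ n * (calDalev L M a ha k)⁻¹) k)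
      (γw⁻¹ * κ' ^ n * Real.exp (κ * 2)) κ :=
  hdec_of_conjBound L M hκ (fun k y => opNorm_conjMat_insertion_le_of_wCoercive (hW k y) hγ (hPc k y) n) k

/-- `κ₀ ≥ 0` and `C₂ ≥ 0` are forced by `PerturbationLaws … κ₀ (C₂L^{−k})` (read at level `0`). [folklore] -/
theorem nonneg_of_perturbationLaws {P : (k : ℕ) → Matrix (idx L M k) (idx L M k) ℂ} {κ₀ C₂ : ℝ}
    (hpert : PerturbationLaws (calDalev L M a ha) P (JpcT L M) κ₀ (fun k => C₂ * ((L : ℝ)⁻¹) ^ k)) : 0 ≤ κ₀ ∧ 0 ≤ C₂ := by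
  refine ⟨(norm_nonneg _).trans (hpert.opNorm_P_mul_inv_le 0), ?_⟩
  have h := (norm_nonneg _).trans (hpert.consistent_le 0)
  rwa [pow_zero, mul_one] at h

/-- PART 116's constant `C_n = (n+1)κ₀^nCJ + nκ₀^{n−1}C₂ + κ₀^n·2dCst` is nonnegative. [folklore] -/
theorem insertionConst_nonneg {κ₀ C₂ : ℝ} (hκ₀ : 0 ≤ κ₀) (hC₂ : 0 ≤ C₂) (n : ℕ) :
    0 ≤ ((n + 1) * κ₀ ^ n * CJ d a + n * κ₀ ^ (n - 1) * C₂) + κ₀ ^ n * (2 * d * Cst d a) := by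
  have h1 := CJ_nonneg d a
  have h2 := Cst_nonneg d a
  positivity

/-- **`decayStations_insertion_king` — THE JOIN: (CONV-C)'s SHAPE FOR EVERY INSERTION ORDER ON KING's TOWER** [our proof] (`L ≥ 2`).  For every perturbation
family with `PerturbationLaws (Δ_a^{(·)}) P J κ₀ (C₂L^{−k})` (PART 116's rate half) and the two weighted letters `hW`, `hPc` at a rate `κ ≥ 0` (the decay half),
and every order `n`: the King-averaged unit-lattice images `c^{(n)}_k = (L^d)^k·Q^{(k)}(𝒢^{(k)}P_k)^n𝒢^{(k)}Q^{(k)ᴴ}` converge to a limit `c^{(n)}_∞` with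
`EntryDecay distK c^{(n)}_∞ B κ`, `B = γw⁻¹κ′^n e^{2κ}`, and King's shapes hold with HALVED exponents:
`‖(c^{(n)}_k − c^{(n)}_∞)(x,y)‖ ≤ √(2B·C_n∕(1−L⁻¹))·(√(L⁻¹))^k·e^{−(κ∕2)·distK(x,y)}`, `‖(c^{(n)}_{k+1} − c^{(n)}_k)(x,y)‖ ≤ √(2B·2C_n∕(1−L⁻¹))·(√(L⁻¹))^k·e^{−(κ∕2)·distK(x,y)}`
(`C_n` PART 116's constant) — `DecayRateInterpolation.decayRate_of_towerLimitRate` on `towerLimitRate_insertion_king` and §3's `hdec`.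
[cite: King1986, Lemma 4.5 (4.38) p.674 (shape of the conclusion; scalar template)] -/
theorem decayStations_insertion_king (hL : 2 ≤ L) {P : (k : ℕ) → Matrix (idx L M k) (idx L M k) ℂ} {κ₀ C₂ : ℝ}
    (hpert : PerturbationLaws (calDalev L M a ha) P (JpcT L M) κ₀ (fun k => C₂ * ((L : ℝ)⁻¹) ^ k))
    {κ γw κ' : ℝ} (hκ : 0 ≤ κ) (hγ : 0 < γw) (hW : ∀ (k : ℕ) (y : idx L M 0), WCoercive (calDalev L M a ha k) κ (rho L M k y) γw)
    (hPc : ∀ (k : ℕ) (y : idx L M 0),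
      ‖conjMat κ (rho L M k y) (rho L M k y) (P k) * conjMat κ (rho L M k y) (rho L M k y) (calDalev L M a ha k)⁻¹‖ ≤ κ')
    (n : ℕ) :
    ∃ clim : Matrix (idx L M 0) (idx L M 0) ℂ,
      Tendsto (avgTow (Qlev L M) ((L : ℝ) ^ d) (fun k => ((calDalev L M a ha k)⁻¹ * P k) ^ n * (calDalev L M a ha k)⁻¹)) atTop (𝓝 clim) ∧
      EntryDecay (distK L M) clim (γw⁻¹ * κ' ^ n * Real.exp (κ * 2)) κ ∧
      DecayRate (distK L M) (avgTow (Qlev L M) ((L : ℝ) ^ d) (fun k => ((calDalev L M a ha k)⁻¹ * P k) ^ n * (calDalev L M a ha k)⁻¹)) clim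
        (Real.sqrt (2 * (γw⁻¹ * κ' ^ n * Real.exp (κ * 2))
          * ((((n + 1) * κ₀ ^ n * CJ d a + n * κ₀ ^ (n - 1) * C₂) + κ₀ ^ n * (2 * d * Cst d a)) / (1 - (L : ℝ)⁻¹))))
        (κ / 2) (Real.sqrt ((L : ℝ)⁻¹)) ∧
      TwoLevelDecayRate (distK L M) (avgTow (Qlev L M) ((L : ℝ) ^ d) (fun k => ((calDalev L M a ha k)⁻¹ * P k) ^ n * (calDalev L M a ha k)⁻¹))
        (Real.sqrt (2 * (γw⁻¹ * κ' ^ n * Real.exp (κ * 2))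
          * (2 * (((n + 1) * κ₀ ^ n * CJ d a + n * κ₀ ^ (n - 1) * C₂) + κ₀ ^ n * (2 * d * Cst d a)) / (1 - (L : ℝ)⁻¹))))
        (κ / 2) (Real.sqrt ((L : ℝ)⁻¹)) := by
  have hL1 : (1 : ℝ) < L := by exact_mod_cast (lt_of_lt_of_le one_lt_two hL : 1 < L)
  have hρ0 : (0 : ℝ) ≤ (L : ℝ)⁻¹ := inv_nonneg.mpr (Nat.cast_nonneg _)
  have hρ1 : ((L : ℝ)⁻¹) < 1 := inv_lt_one_of_one_lt₀ hL1
  obtain ⟨hκ₀, hC₂⟩ := nonneg_of_perturbationLaws L M a ha hpert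
  exact decayRate_of_towerLimitRate hρ0 hρ1 (insertionConst_nonneg (d := d) a hκ₀ hC₂ n) (towerLimitRate_insertion_king L M a ha hL hpert n)
    (hdec_insertion_of_wCoercive L M a ha hκ hγ hW hPc n)

/-- **NON-VACUITY — THE RATE-ZERO FACE IS UNCONDITIONAL** [our proof]: at `κ = 0` the two weighted letters ARE the tree's coercivity of `Δ_a^{(k)}`
(`DirichletRegionTower.coercive_calDalev`, `γ_D = ((d+1)Cst)⁻¹`) and (H-bd) right (`‖P_k𝒢^{(k)}‖ ≤ κ₀`); so for EVERY family obeying `PerturbationLaws` the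
unit-lattice ENTRIES of every insertion image are bounded by `(d+1)Cst·κ₀^n`, uniformly in the level and in the volume. -/
theorem entryBound_insertion_of_perturbationLaws {P : (k : ℕ) → Matrix (idx L M k) (idx L M k) ℂ} {κ₀ : ℝ} {e₂ : ℕ → ℝ}
    (hpert : PerturbationLaws (calDalev L M a ha) P (JpcT L M) κ₀ e₂) (n k : ℕ) :
    EntryDecay (distK L M)
      (avgTow (Qlev L M) ((L : ℝ) ^ d) (fun k => ((calDalev L M a ha k)⁻¹ * P k) ^ n * (calDalev L M a ha k)⁻¹) k)
      (((d : ℝ) + 1) * Cst d a * κ₀ ^ n) 0 := by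
  have hW : ∀ (k : ℕ) (y : idx L M 0), WCoercive (calDalev L M a ha k) 0 (rho L M k y) (gamD d a) :=
    fun k y => wCoercive_zero_of_coercive (fun v => coercive_calDalev L M a ha k v) _
  have hPc : ∀ (k : ℕ) (y : idx L M 0),
      ‖conjMat 0 (rho L M k y) (rho L M k y) (P k) * conjMat 0 (rho L M k y) (rho L M k y) (calDalev L M a ha k)⁻¹‖ ≤ κ₀ := fun k y => by
    rw [conjMat_zero, conjMat_zero]
    exact hpert.opNorm_P_mul_inv_le k
  have h := hdec_insertion_of_wCoercive L M a ha le_rfl (gamD_pos a) hW hPc n k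
  have e : (gamD d a)⁻¹ * κ₀ ^ n * Real.exp (0 * 2) = ((d : ℝ) + 1) * Cst d a * κ₀ ^ n := by
    rw [gamD, inv_inv, zero_mul, Real.exp_zero, mul_one]
  rw [e] at h
  exact h

/-! ## §4 The first-order model: both weighted letters are tree theorems — the (CONV-C) shape for every background-derivative insertion, unconditionally -/

/-- **`hPc_firstOrder` — THE CONJUGATED (H-bd) OF THE FIRST-ORDER MODEL AT THE CANONICAL WEIGHTS** [our proof]: from a conjugation-defect bound `J` of `Δ_a^{(k)}`
at `ρ_{k,y}` (`0 ≤ J < γ_D`) and the size `α` of the coefficient fields, `‖c(P_k)·c((Δ_a^{(k)})⁻¹)‖ ≤ d·α·G2 d a J (γ_D − J) κ` — `CTConjugatedHbd.opNorm_conjMat_firstOrder_le`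
with the fine-Lipschitz property (G1) of the canonical weights (`abs_rho_fineStep_le`). -/
theorem hPc_firstOrder {V : (k : ℕ) → Fin d → (idx L M k → ℂ)} {α β : ℝ} (hV : LipschitzBackground L M V α β) {κ J : ℝ} (hJ0 : 0 ≤ J)
    (hJγ : J < gamD d a) (k : ℕ) (y : idx L M 0) (hJ : CTWeightedCoercivity.ConjDefect (calDalev L M a ha k) κ (rho L M k y) J) :
    ‖conjMat κ (rho L M k y) (rho L M k y) (Pmodel L M V k) * conjMat κ (rho L M k y) (rho L M k y) (calDalev L M a ha k)⁻¹‖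
      ≤ d * (α * G2 d a J (gamD d a - J) κ) :=
  opNorm_conjMat_firstOrder_le (lev L k) (one_le_lev' L k) M a ha hJ hJ0 hJγ (fun x μ ν => abs_rho_fineStep_le L M k y x μ ν) hV.nonneg.1
    (hV.bound k)

/-- **`decayStations_firstOrderInsertion` — (CONV-C)'s SHAPE FOR EVERY BACKGROUND-DERIVATIVE INSERTION OF A LIPSCHITZ CONNECTION, UNCONDITIONALLY** [our proof]
(`L ≥ 2`, `d ≥ 1`).  For coefficient fields `V` with `LipschitzBackground V α β`, `P_k = Σ_μ diag(V^{(k)}_μ)∇^{(k)}_μ`, an auxiliary mass `a′ > 0` and every rate `κ ≥ 0`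
below the three closed-form thresholds `Jfree d a′ κ 1 < γ′(a′)`, `deltaK d a′ κ 1 < σ₀(a′)²`, `JA d a a′ κ 1 < γ_D` (all met near `κ = 0`: §5), and EVERY order `n`:
the King-averaged unit-lattice images `c^{(n)}_k` of the `n`-th insertion chain `(𝒢^{(k)}P_k)^n𝒢^{(k)}` converge to a limit `c^{(n)}_∞` with entry decay at rate `κ`, and
  `‖(c^{(n)}_k − c^{(n)}_∞)(x,y)‖ ≤ √(2B_n·C_n∕(1−L⁻¹))·(√(L⁻¹))^k·e^{−(κ∕2)·distK(x,y)}`,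
  `‖(c^{(n)}_{k+1} − c^{(n)}_k)(x,y)‖ ≤ √(2B_n·2C_n∕(1−L⁻¹))·(√(L⁻¹))^k·e^{−(κ∕2)·distK(x,y)}`
for all `k, x, y`, with `B_n = (γ_D − J)⁻¹(dαG₂)^n e^{2κ}`, `J = max (JA d a a′ κ 1) 0`, `G₂ = CTConjugatedHbd.G2 d a J (γ_D − J) κ`, `C_n` PART 116's constant at
`κ₀ = d(α+β)Cst`, `C₂ = C2model`.  A geometric RATE in the level AND an exponential DECAY in the unit-lattice distance, every constant free of the level `k`
and of the torus `M` — NO displayed binder (the weighted letters are `CTConjDefectDischarge.conjDefect_calDalev_rho` + `CTConjugatedHbd`, the rate half is PART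
116 over NE2's `perturbationLaws_firstOrder`). [cite: King1986, Lemma 4.5 (4.38) p.674 (shape of the conclusion; scalar template)] -/
theorem decayStations_firstOrderInsertion (hL : 2 ≤ L) (hd : 1 ≤ d) {V : (k : ℕ) → Fin d → (idx L M k → ℂ)} {α β : ℝ}
    (hV : LipschitzBackground L M V α β) {a' κ : ℝ} (ha' : 0 < a') (hκ : 0 ≤ κ) (hγ' : Jfree d a' κ 1 < gammaPs d a')
    (hδ' : deltaK d a' κ 1 < sigma0 d a' ^ 2) (hJA : JA d a a' κ 1 < gamD d a) (n : ℕ) :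
    ∃ clim : Matrix (idx L M 0) (idx L M 0) ℂ,
      Tendsto (avgTow (Qlev L M) ((L : ℝ) ^ d) (fun k => ((calDalev L M a ha k)⁻¹ * Pmodel L M V k) ^ n * (calDalev L M a ha k)⁻¹)) atTop
        (𝓝 clim) ∧
      EntryDecay (distK L M) clim
        ((gamD d a - max (JA d a a' κ 1) 0)⁻¹ * (d * (α * G2 d a (max (JA d a a' κ 1) 0) (gamD d a - max (JA d a a' κ 1) 0) κ)) ^ n
          * Real.exp (κ * 2)) κ ∧
      DecayRate (distK L M) (avgTow (Qlev L M) ((L : ℝ) ^ d) (fun k => ((calDalev L M a ha k)⁻¹ * Pmodel L M V k) ^ n * (calDalev L M a ha k)⁻¹))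
        clim
        (Real.sqrt (2 * ((gamD d a - max (JA d a a' κ 1) 0)⁻¹
            * (d * (α * G2 d a (max (JA d a a' κ 1) 0) (gamD d a - max (JA d a a' κ 1) 0) κ)) ^ n * Real.exp (κ * 2))
          * ((((n + 1) * (d * (α + β) * Cst d a) ^ n * CJ d a + n * (d * (α + β) * Cst d a) ^ (n - 1) * C2model d L a α β)
              + (d * (α + β) * Cst d a) ^ n * (2 * d * Cst d a)) / (1 - (L : ℝ)⁻¹))))
        (κ / 2) (Real.sqrt ((L : ℝ)⁻¹)) ∧
      TwoLevelDecayRate (distK L M)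
        (avgTow (Qlev L M) ((L : ℝ) ^ d) (fun k => ((calDalev L M a ha k)⁻¹ * Pmodel L M V k) ^ n * (calDalev L M a ha k)⁻¹))
        (Real.sqrt (2 * ((gamD d a - max (JA d a a' κ 1) 0)⁻¹
            * (d * (α * G2 d a (max (JA d a a' κ 1) 0) (gamD d a - max (JA d a a' κ 1) 0) κ)) ^ n * Real.exp (κ * 2))
          * (2 * (((n + 1) * (d * (α + β) * Cst d a) ^ n * CJ d a + n * (d * (α + β) * Cst d a) ^ (n - 1) * C2model d L a α β)
              + (d * (α + β) * Cst d a) ^ n * (2 * d * Cst d a)) / (1 - (L : ℝ)⁻¹))))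
        (κ / 2) (Real.sqrt ((L : ℝ)⁻¹)) := by
  have hJ0 : 0 ≤ max (JA d a a' κ 1) 0 := le_max_right _ _
  have hJγ : max (JA d a a' κ 1) 0 < gamD d a := max_JA_lt_gamD a hJA
  have hW : ∀ (k : ℕ) (y : idx L M 0), WCoercive (calDalev L M a ha k) κ (rho L M k y) (gamD d a - max (JA d a a' κ 1) 0) :=
    fun k y => wCoercive_calDa_of_conjDefect (lev L k) (one_le_lev' L k) M a ha (conjDefect_calDalev_rho L M a ha ha' hγ' hδ' k y)
  have hPc : ∀ (k : ℕ) (y : idx L M 0),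
      ‖conjMat κ (rho L M k y) (rho L M k y) (Pmodel L M V k) * conjMat κ (rho L M k y) (rho L M k y) (calDalev L M a ha k)⁻¹‖
        ≤ d * (α * G2 d a (max (JA d a a' κ 1) 0) (gamD d a - max (JA d a a' κ 1) 0) κ) :=
    fun k y => hPc_firstOrder L M a ha hV hJ0 hJγ k y (conjDefect_calDalev_rho L M a ha ha' hγ' hδ' k y)
  exact decayStations_insertion_king L M a ha hL (perturbationLaws_firstOrder L M a ha hd hV) hκ (sub_pos.mpr hJγ) hW hPc n

/-- the first-order chain `n = 1` in propagator notation: `(Δ_a^{(k)})⁻¹P_k(Δ_a^{(k)})⁻¹ = 𝒢^{(k)}·(V^{(k)}·∇^{(k)})·𝒢^{(k)}` — the tower of PART 116's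
`towerLimitRate_firstOrderInsertion_one`, i.e. `−∂_t|_{t=0}(Δ_a^{(k)} + tP_k)⁻¹` (PART 115 §5). [folklore] -/
theorem insertionTower_one_eq (V : (k : ℕ) → Fin d → (idx L M k → ℂ)) :
    (fun k => ((calDalev L M a ha k)⁻¹ * Pmodel L M V k) ^ 1 * (calDalev L M a ha k)⁻¹)
      = fun k => calGlev L M a ha k * Pmodel L M V k * calGlev L M a ha k := by
  funext k
  rw [pow_one, calDalev_inv]

/-! ## §5 The quantifier order of (CONV-C): one rate `κ > 0` for all tori, all Lipschitz backgrounds and all orders -/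

/-- **an admissible rate exists** (auxiliary mass `a′ = 1`): `∃ κ ∈ (0, 1]` with `Jfree d 1 κ 1 < γ′(1)`, `deltaK d 1 κ 1 < σ₀(1)²`, `JA d a 1 κ 1 < γ_D` — the three
`CTAdmissibleRate` windows at `𝓝 0`, intersected; `κ` depends on `(d, a)` only. [folklore] -/
theorem exists_admissible_rate (d : ℕ) (a : ℝ) :
    ∃ κ : ℝ, 0 < κ ∧ κ ≤ 1 ∧ Jfree d 1 κ 1 < gammaPs d 1 ∧ deltaK d 1 κ 1 < sigma0 d 1 ^ 2 ∧ JA d a 1 κ 1 < gamD d a :=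
  exists_pos_le_one_of_eventually
    ((eventually_Jfree_lt d 1 1).and ((eventually_deltaK_lt d one_pos 1).and (eventually_JA_lt d a one_pos 1 (gamD_pos (d := d) a))))

/-- **`exists_rate_firstOrderInsertion` — (CONV-C)'s QUANTIFIER ORDER FOR THE u-DERIVATIVE INSERTION CHAINS OF THE FIRST-ORDER MODEL** [our proof] (`L ≥ 2`, `d ≥ 1`):
there is ONE rate `κ ∈ (0, 1]`, depending on `(d, a)` only, such that FOR EVERY torus `M`, EVERY Lipschitz background `V` (constants `α, β`) and EVERY order `n`, the
King-averaged unit-lattice images `c^{(n)}_k` of `(𝒢^{(k)}P_k)^n𝒢^{(k)}` satisfy, for all `k, x, y`,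
  `‖(c^{(n)}_{k+1} − c^{(n)}_k)(x,y)‖ ≤ B·(√(L⁻¹))^k·e^{−(κ∕2)·distK(x,y)}`
with `B = B(d, L, a, α, β, κ, n)` the closed-form constant of §4 at `a′ = 1` — a GEOMETRIC RATE `√(L⁻¹) < 1` in the level together with an EXPONENTIAL DECAY
`κ∕2 > 0` in the unit-lattice distance, constants free of the level and of the volume: the literal shape «`|𝒦^{(k+1)} − 𝒦^{(k)}|(y,y′) ≤ C₄θ^k e^{−δ₄|y−y′|}`,
`θ, C₄, δ₄` depending on `(d, L, N)`» of (CONV-C) for this constituent class, AT MODEL LEVEL (first-order coupling, King's averaging), with NO displayed binder.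
[cite: King1986, Lemma 4.5 (4.38) p.674 (shape of the conclusion; scalar template)] -/
theorem exists_rate_firstOrderInsertion {d : ℕ} (L : ℕ) [NeZero L] (hL : 2 ≤ L) (hd : 1 ≤ d) (a : ℝ) (ha : 0 < a) :
    ∃ κ : ℝ, 0 < κ ∧ κ ≤ 1 ∧
      ∀ (M : Fin d → ℕ) [∀ μ, NeZero (M μ)] (V : (k : ℕ) → Fin d → (idx L M k → ℂ)) (α β : ℝ) (_hV : LipschitzBackground L M V α β) (n : ℕ),
        TwoLevelDecayRate (distK L M)
          (avgTow (Qlev L M) ((L : ℝ) ^ d) (fun k => ((calDalev L M a ha k)⁻¹ * Pmodel L M V k) ^ n * (calDalev L M a ha k)⁻¹))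
          (Real.sqrt (2 * ((gamD d a - max (JA d a 1 κ 1) 0)⁻¹
              * (d * (α * G2 d a (max (JA d a 1 κ 1) 0) (gamD d a - max (JA d a 1 κ 1) 0) κ)) ^ n * Real.exp (κ * 2))
            * (2 * (((n + 1) * (d * (α + β) * Cst d a) ^ n * CJ d a + n * (d * (α + β) * Cst d a) ^ (n - 1) * C2model d L a α β)
                + (d * (α + β) * Cst d a) ^ n * (2 * d * Cst d a)) / (1 - (L : ℝ)⁻¹))))
          (κ / 2) (Real.sqrt ((L : ℝ)⁻¹)) := by
  obtain ⟨κ, hκ0, hκ1, hγ', hδ', hJA⟩ := exists_admissible_rate d a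
  refine ⟨κ, hκ0, hκ1, fun M _ V α β hV n => ?_⟩
  obtain ⟨_, _, _, _, h2⟩ := decayStations_firstOrderInsertion L M a ha hL hd hV one_pos hκ0.le hγ' hδ' hJA n
  exact h2

end Tower

end Summit.QuantumFields.BalabanUV.Beta.GAN24.InsertionChainDecay

end
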